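import Literature.NumberTheory.Weil1965.AdelicGaussTransformMajorantCutoff
import Literature.NumberTheory.Weil1965.AdelicSiegelCoeffHeightBound
import HarnessLib

/-!
# Cut-off continuity of Weil's Eisenstein functional `E_X` for a quadratic form: `E_X(Ψ c_n) → E_X(Ψ)`, `∫ Ψ dE_X = E_X(Ψ)`

Topic `NumberTheory/Weil1965`; namespace `Literature.NumberTheory.Weil1965`.  KERNEL mathematics only (theorems; no definition,
no named fact, no `axiom`, no `sorry`).  Sequel of ★ `AdelicFibreMeasuresCutoff` (§3 there: `E_X(Ψ c_n) → E_X(Ψ)` GIVEN a summable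
majorant `‖F*_{Ψ c_n}(ξ)‖ ≤ m(ξ)` UNIFORM in `n` — hypothesis `hdom`), of ★ `AdelicSiegelCoeffHeightBound` (`F*_Φ(ξ) =
∫ chirp(ξ•S) Φ dμ` for `h = q_S`, Weil's condition (B)), of ★ `AdelicGaussTransformMajorant` ED. 2 (the majorant UNIFORM over an
archimedean family with bounded Schwartz seminorms, `exists_norm_integral_chirp_smul_ratMatrix_tensor_le_vecHeight_of_uniform`) and
of ★ `AdelicGaussTransformMajorantCutoff` (the majorant UNIFORM along a tensor cut-off family, modulo that tensor bound `hUT`).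

For a totally real `F`, `S ∈ Sym_m(F)` with `det S ≠ 0`, `4 < m`, the quadratic map `h = q_S : x ↦ x S xᵀ` and TENSOR CUT-OFFS
`c_n = θ_n ⊗ 𝟙_{U_n} ∈ 𝒮_ℝ(𝔸_F^m)` (`θ_n` smooth real functions on `(F ⊗ ℝ)^m` with UNIFORMLY bounded derivatives — e.g. the dilated
bumps `β_n = β_0((n+1)⁻¹ ·)` of ★ `exists_tensor_cutoff_dilate` — and `U_n` a compact open exhaustion of `(𝔸_F^∞)^m`):

* §1 `exists_uniform_tensor_bound_of_bounded_derivs` — the hypothesis `hUT` of ★ `AdelicGaussTransformMajorantCutoff` holds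
  (uniform seminorms of `Φ_∞ θ_n`, ★ `exists_forall_seminorm_smulLeftCLM_le_of_bounded_derivs`, fed to the uniform tensor majorant);
  `exists_norm_integral_chirp_mul_cutoff_le_of_bounded_derivs` — ONE constant `‖∫ chirp(η•S) (Φ c_n) dν‖ ≤ C · h(1,η)^{−m/2}` for
  all `n`, all adeles `η`, every `Φ ∈ 𝒮(𝔸_F^m)`;
* §2 `exists_summable_forall_norm_adelicSiegelCoeff_mul_cutoff_le` — at rational `ξ`, `h(1,ξ) ≥ H(ξ)` and
  `Σ_ξ H(ξ)^{−m/2} < ∞` (★ `summable_classicalHeight_rpow_neg`, `m/2 > 2`): ONE summable `M(ξ) = C · H(ξ)^{−m/2}` with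
  `‖F*_{Ψ c_n}(ξ)‖ ≤ M(ξ)` for all `n`, `ξ` — the hypothesis `hdom`; hence
  **`tendsto_adelicSiegelFunctional_sdForm_mul_cutoff`** — `E_X(Ψ c_n) → E_X(Ψ)` for every `Ψ ∈ 𝒮_ℝ(𝔸_F^m)`
  (★ `tendsto_adelicSiegelFunctional_cutoff`) and **`integral_adelicSiegelMeasure_sdForm_eq`** — `Ψ ∈ L¹(ν_E)` and
  `∫ Ψ dν_E = E_X(Ψ)` for `0 ≤ Ψ ∈ 𝒮_ℝ(𝔸_F^m)` (★ `integral_adelicSiegelMeasure_eq_of_dominated`);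
* §3 **`exists_cutoff_tendsto_adelicSiegelFunctional_sdForm`** — ONE cut-off sequence `c_n ∈ 𝒮_ℝ`, `0 ≤ c_n ≤ 1`, compactly
  supported, eventually `= 1` at every point (the dilation family of ★ `exists_tensor_cutoff_dilate`), along which `E_X` is
  continuous for every `Ψ` and `∫ Ψ dE_X = E_X(Ψ)` for every `Ψ ≥ 0`: the `h₁` ∕ `c` input of ★
  `linearMap_eq_of_schwartzBruhatMeasure_eq` ∕ ★ `linearMap_eq_smul_of_fibreMeasure_eq` on the Eisenstein side of the Siegel–Weil
  comparison (the theta side is ★ `tendsto_thetaOrbitFunctionalReal_mul` along the same `c_n`).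

This is Weil's "convergence uniforme sur toute partie compacte de `𝒮(X)`" for `E_X` [Weil1965, Chap. I n° 2, Lemme 5 and Prop. 2
(B₁); Chap. IV n° 41 (35): "`μ_b` est une mesure positive tempérée … `E_X = Σ μ_b`"]: the functional `E_X` IS its measure.

Cell `hodgecm-mathlib`, FLOOR 0, crux H413 (stmt-HodgeConjecture-24833), E-2 ∕ SW2 road (W), row «hdom» (F0P4-p06 (g3); uniform FILE A∕C
= A-p08 (g17)).  HC_CM is proved only modulo the printed citations until rung 0 closes; this file is unconditional.

## References
* [Weil1965] A. Weil, *Sur la formule de Siegel dans la théorie des groupes classiques*, Acta Math. 113 (1965): Chap. I n° 2,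
  Lemmes 2–5 and Prop. 2, pp. 7–12; Chap. IV n° 40 Thm. 1 (p. 57), n° 41 (34)–(35) (p. 59).
* [Garrett2018] P. Garrett, *Modern Analysis of Automorphic Forms by Example* (2018), §2.2 (heights).
-/

set_option autoImplicit false

noncomputable section

open MeasureTheory Filter Topology Set NumberField NumberField.InfinitePlace NumberField.mixedEmbedding IsDedekindDomain
open scoped NNReal ENNReal Matrix Classical SchwartzMap ContDiff
open Literature.NumberTheory.Automorphic Literature.NumberTheory.Weil1964 Literature.Analysis.Distribution

namespace Literature.NumberTheory.Weil1965

/-! ## §1 The uniform tensor bound `hUT` and the cut-off majorant, unconditionally -/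

section Majorant

variable (F : Type) [Field F] [NumberField F] [IsTotallyReal F] {m : ℕ}
  [MeasurableSpace (AdeleRing (𝓞 F) F)] [BorelSpace (AdeleRing (𝓞 F) F)]

/-- **THE UNIFORM TENSOR BOUND `hUT`**: for smooth real multipliers `θ_n` with uniformly bounded derivatives, a Schwartz `Φ_∞` and a
Schwartz–Bruhat `Φ_f`, ONE constant `A` with `‖∫ chirp(η•S) ((Φ_∞ θ_n) ⊗ Φ_f) dν‖ ≤ A · h(1,η)^{−m/2}` for all `n` and all adeles `η`
(the family `{Φ_∞ θ_n}_n` has uniformly bounded Schwartz seminorms, ★ `exists_forall_seminorm_smulLeftCLM_le_of_bounded_derivs`,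
so the uniform majorant ★ `exists_norm_integral_chirp_smul_ratMatrix_tensor_le_vecHeight_of_uniform` applies).
[cite: Weil1965, Chap. I n° 2, Prop. 2, p. 8; Chap. IV n° 41, pp. 58–59] -/
theorem exists_uniform_tensor_bound_of_bounded_derivs (ν : Measure (Fin m → AdeleRing (𝓞 F) F)) [ν.IsAddHaarMeasure]
    {S : Matrix (Fin m) (Fin m) F} (hS : S.IsSymm) (hdet : S.det ≠ 0)
    {θ : ℕ → (Fin m → mixedSpace F) → ℝ} (hθs : ∀ n, ContDiff ℝ ∞ (θ n))
    (hθb : ∀ N : ℕ, ∃ C : ℝ, 0 ≤ C ∧ ∀ n, ∀ i ≤ N, ∀ y, ‖iteratedFDeriv ℝ i (θ n) y‖ ≤ C)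
    (Φinf : 𝓢((Fin m → mixedSpace F), ℂ)) {Φfin : (Fin m → FiniteAdeleRing (𝓞 F) F) → ℂ}
    (hfin : Φfin ∈ SchwartzBruhat (Fin m → FiniteAdeleRing (𝓞 F) F)) :
    ∃ A : ℝ, 0 ≤ A ∧ ∀ (n : ℕ) (η : AdeleRing (𝓞 F) F),
      ‖∫ x, chirp F (η • ratMatrix F S)
          (fun v => SchwartzMap.smulLeftCLM ℂ (fun y => (θ n y : ℂ)) Φinf (piArch F (Fin m) v) *
            Φfin (piFinite F (Fin m) v)) x ∂ν‖ ≤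
        A * (vecHeight F (![1, η] : Fin 2 → AdeleRing (𝓞 F) F) : ℝ) ^ (-((m : ℝ) / 2)) := by
  have hf : ∀ p : ℕ × ℕ, ∃ M : ℝ, ∀ n ∈ (Set.univ : Set ℕ), SchwartzMap.seminorm ℂ p.1 p.2
      (SchwartzMap.smulLeftCLM ℂ (fun y => (θ n y : ℂ)) Φinf) ≤ M := fun p =>
    exists_forall_seminorm_smulLeftCLM_le_of_bounded_derivs (T := (Set.univ : Set ℕ)) (fun n _ => hθs n)
      (fun N => by
        obtain ⟨C, hC0, hC⟩ := hθb N
        exact ⟨C, hC0, fun n _ => hC n⟩) Φinf p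
  obtain ⟨A, hA0, hA⟩ := exists_norm_integral_chirp_smul_ratMatrix_tensor_le_vecHeight_of_uniform F ν hS hdet hf hfin
  exact ⟨A, hA0, fun n η => hA n (Set.mem_univ n) η⟩

/-- **THE MAJORANT (B) UNIFORMLY ALONG A TENSOR CUT-OFF FAMILY, every `Φ ∈ 𝒮(𝔸_F^m)`**: for `F` totally real, `S ∈ Sym_m(F)`,
`det S ≠ 0`, and cut-offs `c_n = θ_n ⊗ 𝟙_{U_n}` (smooth `θ_n` with uniformly bounded derivatives, `U_n` a compact open exhaustion),
ONE constant `C` with `‖∫ chirp(η•S) (Φ c_n) dν‖ ≤ C · h(1,η)^{−m/2}` for all `n` and all adeles `η`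
(★ `exists_norm_integral_chirp_mul_cutoff_le` with `hUT` discharged).
[cite: Weil1965, Chap. I n° 2, Lemme 5 p. 10 and Prop. 2 p. 8; Chap. IV n° 41, pp. 58–59] -/
theorem exists_norm_integral_chirp_mul_cutoff_le_of_bounded_derivs (ν : Measure (Fin m → AdeleRing (𝓞 F) F))
    [ν.IsAddHaarMeasure] {S : Matrix (Fin m) (Fin m) F} (hS : S.IsSymm) (hdet : S.det ≠ 0)
    {θ : ℕ → (Fin m → mixedSpace F) → ℝ} (hθs : ∀ n, ContDiff ℝ ∞ (θ n))
    (hθb : ∀ N : ℕ, ∃ C : ℝ, 0 ≤ C ∧ ∀ n, ∀ i ≤ N, ∀ y, ‖iteratedFDeriv ℝ i (θ n) y‖ ≤ C)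
    {U : ℕ → Set (Fin m → FiniteAdeleRing (𝓞 F) F)} (hUc : ∀ n, IsCompact (U n)) (hUo : ∀ n, IsOpen (U n))
    (hUmono : Monotone U) (hUcov : ∀ z, ∃ n, z ∈ U n)
    (c : ℕ → (Fin m → AdeleRing (𝓞 F) F) → ℝ)
    (hc : ∀ n v, c n v = θ n (piArch F (Fin m) v) * (U n).indicator 1 (piFinite F (Fin m) v))
    {Φ : (Fin m → AdeleRing (𝓞 F) F) → ℂ} (hΦ : Φ ∈ piSchwartzBruhat F (Fin m)) :
    ∃ C : ℝ, 0 ≤ C ∧ ∀ (n : ℕ) (η : AdeleRing (𝓞 F) F),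
      ‖∫ x, chirp F (η • ratMatrix F S) (fun v => Φ v * (c n v : ℂ)) x ∂ν‖ ≤
        C * (vecHeight F (![1, η] : Fin 2 → AdeleRing (𝓞 F) F) : ℝ) ^ (-((m : ℝ) / 2)) :=
  exists_norm_integral_chirp_mul_cutoff_le F ν hS hdet hθs hθb hUc hUo hUmono hUcov c hc
    (fun Φinf _ hfin => exists_uniform_tensor_bound_of_bounded_derivs F ν hS hdet hθs hθb Φinf hfin) hΦ

end Majorant

/-! ## §2 Rational points: the uniform condition (B) (`hdom`), cut-off continuity of `E_X`, `∫ Ψ dE_X = E_X(Ψ)` -/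

section Eisenstein

variable (F : Type) [Field F] [NumberField F] [IsTotallyReal F] {m : ℕ}
  [MeasurableSpace (adeleQuotient F)] [BorelSpace (adeleQuotient F)]
  [MeasurableSpace (AdeleRing (𝓞 F) F)] [BorelSpace (AdeleRing (𝓞 F) F)]

omit [MeasurableSpace (adeleQuotient F)] [BorelSpace (adeleQuotient F)] in
/-- **THE UNIFORM CONDITION (B) ALONG A CUT-OFF FAMILY** (the hypothesis `hdom` of ★ `tendsto_adelicSiegelFunctional_cutoff`):
for a totally real `F`, `S ∈ Sym_m(F)` with `det S ≠ 0`, `4 < m`, `Ψ ∈ 𝒮_ℝ(𝔸_F^m)` and cut-offs `c_n = θ_n ⊗ 𝟙_{U_n}` (smooth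
`θ_n` with uniformly bounded derivatives, `U_n` a compact open exhaustion), there is ONE summable `M : F → ℝ`,
`M(ξ) = C · H(ξ)^{−m/2}` (`H` the classical height), with `‖F*_{Ψ c_n}(ξ)‖ ≤ M(ξ)` for all `n` and all `ξ ∈ F`.
[cite: Weil1965, Chap. I n° 2, Prop. 2 (B₁), p. 8; Chap. IV n° 40 Thm. 1, p. 57; n° 41, p. 59] -/
theorem exists_summable_forall_norm_adelicSiegelCoeff_mul_cutoff_le (μ : Measure (Fin m → AdeleRing (𝓞 F) F))
    [μ.IsAddHaarMeasure] (hm : 4 < m) {S : Matrix (Fin m) (Fin m) F} (hS : S.IsSymm) (hdet : S.det ≠ 0)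
    {θ : ℕ → (Fin m → mixedSpace F) → ℝ} (hθs : ∀ n, ContDiff ℝ ∞ (θ n))
    (hθb : ∀ N : ℕ, ∃ C : ℝ, 0 ≤ C ∧ ∀ n, ∀ i ≤ N, ∀ y, ‖iteratedFDeriv ℝ i (θ n) y‖ ≤ C)
    {U : ℕ → Set (Fin m → FiniteAdeleRing (𝓞 F) F)} (hUc : ∀ n, IsCompact (U n)) (hUo : ∀ n, IsOpen (U n))
    (hUmono : Monotone U) (hUcov : ∀ z, ∃ n, z ∈ U n)
    (c : ℕ → (Fin m → AdeleRing (𝓞 F) F) → ℝ)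
    (hc : ∀ n v, c n v = θ n (piArch F (Fin m) v) * (U n).indicator 1 (piFinite F (Fin m) v))
    (Ψ : piSchwartzBruhatReal F (Fin m)) :
    ∃ M : F → ℝ, Summable M ∧ ∀ (n : ℕ) (ξ : F),
      ‖adelicSiegelCoeff F (Fin m) μ (fun x => sdForm F (ratMatrix F S) x)
        (fun v => ((((Ψ : (Fin m → AdeleRing (𝓞 F) F) → ℝ) v * c n v : ℝ)) : ℂ)) ξ‖ ≤ M ξ := by
  have hΨ := Ψ.2
  rw [mem_piSchwartzBruhatReal_iff] at hΨ
  obtain ⟨C, hC0, hC⟩ := exists_norm_integral_chirp_mul_cutoff_le_of_bounded_derivs F μ hS hdet hθs hθb hUc hUo hUmono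
    hUcov c hc hΨ
  have hτ : (2 : ℝ) < (m : ℝ) / 2 := by
    have : (4 : ℝ) < m := by exact_mod_cast hm
    linarith
  refine ⟨fun ξ => C * ((((∏ w : InfinitePlace F, (max 1 ‖((ξ : F) : w.Completion)‖₊) ^ w.mult) *
      ∏ᶠ v : HeightOneSpectrum (𝓞 F), max 1 ‖((ξ : F) : v.adicCompletion F)‖₊ : ℝ≥0) : ℝ)) ^ (-((m : ℝ) / 2)),
    (summable_classicalHeight_rpow_neg F hτ).mul_left C, fun n ξ => ?_⟩
  have heq : (fun v => ((((Ψ : (Fin m → AdeleRing (𝓞 F) F) → ℝ) v * c n v : ℝ)) : ℂ)) =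
      fun v => (((Ψ : (Fin m → AdeleRing (𝓞 F) F) → ℝ) v : ℝ) : ℂ) * (c n v : ℂ) :=
    funext fun v => Complex.ofReal_mul _ _
  rw [heq, adelicSiegelCoeff_sdForm_eq_integral_chirp]
  refine (hC n _).trans (mul_le_mul_of_nonneg_left ?_ hC0)
  have h1 : (1 : ℝ≥0) ≤ (∏ w : InfinitePlace F, (max 1 ‖((ξ : F) : w.Completion)‖₊) ^ w.mult) *
      ∏ᶠ v : HeightOneSpectrum (𝓞 F), max 1 ‖((ξ : F) : v.adicCompletion F)‖₊ :=
    one_le_classicalHeight_adele F (algebraMap F (AdeleRing (𝓞 F) F) ξ)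
  have hpos : (0 : ℝ) < (((∏ w : InfinitePlace F, (max 1 ‖((ξ : F) : w.Completion)‖₊) ^ w.mult) *
      ∏ᶠ v : HeightOneSpectrum (𝓞 F), max 1 ‖((ξ : F) : v.adicCompletion F)‖₊ : ℝ≥0) : ℝ) :=
    lt_of_lt_of_le zero_lt_one (by exact_mod_cast h1)
  have hle : (∏ w : InfinitePlace F, (max 1 ‖((ξ : F) : w.Completion)‖₊) ^ w.mult) *
      ∏ᶠ v : HeightOneSpectrum (𝓞 F), max 1 ‖((ξ : F) : v.adicCompletion F)‖₊ ≤
      vecHeight F (![1, algebraMap F (AdeleRing (𝓞 F) F) ξ] : Fin 2 → AdeleRing (𝓞 F) F) :=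
    classicalHeight_le_vecHeight_vecCons_one_adele F (algebraMap F (AdeleRing (𝓞 F) F) ξ)
  exact Real.rpow_le_rpow_of_nonpos hpos (by exact_mod_cast hle) (neg_nonpos.2 (by positivity))

omit [MeasurableSpace (adeleQuotient F)] [BorelSpace (adeleQuotient F)] in
/-- **CUT-OFF CONTINUITY OF WEIL'S EISENSTEIN FUNCTIONAL `E_X` FOR THE QUADRATIC MAP `x ↦ x S xᵀ`**: along every tensor
cut-off sequence `c_n = θ_n ⊗ 𝟙_{U_n} ∈ 𝒮_ℝ(𝔸_F^m)` with `|c_n| ≤ 1`, `c_n → 1` pointwise, smooth `θ_n` with UNIFORMLY bounded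
derivatives and `U_n` a compact open exhaustion of `(𝔸_F^∞)^m` (e.g. the dilation cut-offs of ★ `exists_tensor_cutoff_dilate`),
`E_X(Ψ c_n) → E_X(Ψ)` for every `Ψ ∈ 𝒮_ℝ(𝔸_F^m)` (`F` totally real, `S` symmetric, `det S ≠ 0`, `4 < m`; `E_X` built on any proof `hB`
of condition (B), e.g. ★ `summable_norm_adelicSiegelCoeff_sdForm`) — Weil's "convergence uniforme sur toute partie compacte de
`𝒮(X)`" for `E_X`, by Tannery's theorem with the uniform majorant (B).
[cite: Weil1965, Chap. I n° 2, Lemme 5 p. 10 and Prop. 2 p. 8; Chap. IV n° 41, p. 59] -/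
theorem tendsto_adelicSiegelFunctional_sdForm_mul_cutoff (μ : Measure (Fin m → AdeleRing (𝓞 F) F))
    [μ.IsAddHaarMeasure] (hm : 4 < m) {S : Matrix (Fin m) (Fin m) F} (hS : S.IsSymm) (hdet : S.det ≠ 0)
    (hh : Continuous fun x : Fin m → AdeleRing (𝓞 F) F => sdForm F (ratMatrix F S) x)
    (hB : ∀ Φ ∈ piSchwartzBruhat F (Fin m), Summable fun ξ : F =>
      ‖adelicSiegelCoeff F (Fin m) μ (fun x => sdForm F (ratMatrix F S) x) Φ ξ‖)
    {θ : ℕ → (Fin m → mixedSpace F) → ℝ} (hθs : ∀ n, ContDiff ℝ ∞ (θ n))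
    (hθb : ∀ N : ℕ, ∃ C : ℝ, 0 ≤ C ∧ ∀ n, ∀ i ≤ N, ∀ y, ‖iteratedFDeriv ℝ i (θ n) y‖ ≤ C)
    {U : ℕ → Set (Fin m → FiniteAdeleRing (𝓞 F) F)} (hUc : ∀ n, IsCompact (U n)) (hUo : ∀ n, IsOpen (U n))
    (hUmono : Monotone U) (hUcov : ∀ z, ∃ n, z ∈ U n)
    (c : ℕ → (Fin m → AdeleRing (𝓞 F) F) → ℝ)
    (hc : ∀ n v, c n v = θ n (piArch F (Fin m) v) * (U n).indicator 1 (piFinite F (Fin m) v))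
    (hcS : ∀ n, c n ∈ piSchwartzBruhatReal F (Fin m)) (hc1 : ∀ n v, |c n v| ≤ 1)
    (hct : ∀ v, Tendsto (fun n => c n v) atTop (𝓝 1)) (Ψ : piSchwartzBruhatReal F (Fin m)) :
    Tendsto (fun n => adelicSiegelFunctional F (Fin m) μ (fun x => sdForm F (ratMatrix F S) x) hh hB
        ⟨(Ψ : (Fin m → AdeleRing (𝓞 F) F) → ℝ) * c n, mul_mem_piSchwartzBruhatReal Ψ.2 (hcS n)⟩) atTop
      (𝓝 (adelicSiegelFunctional F (Fin m) μ (fun x => sdForm F (ratMatrix F S) x) hh hB Ψ)) := by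
  obtain ⟨M, hM, hdom⟩ := exists_summable_forall_norm_adelicSiegelCoeff_mul_cutoff_le F μ hm hS hdet hθs hθb hUc hUo
    hUmono hUcov c hc Ψ
  exact tendsto_adelicSiegelFunctional_cutoff F (Fin m) hh hB Ψ c hcS hc1 hct hM hdom

/-- **WEIL'S `E_X` IS ITS RADON MEASURE on `Ψ ≥ 0`** for the quadratic map `x ↦ x S xᵀ` (`F` totally real, `S` symmetric,
`det S ≠ 0`, `4 < m`): `Ψ ∈ L¹(ν_E)` and `∫ Ψ dν_E = E_X(Ψ)` for every `0 ≤ Ψ ∈ 𝒮_ℝ(𝔸_F^m)`, `ν_E = adelicSiegelMeasure`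
— given one tensor cut-off family as in `tendsto_adelicSiegelFunctional_sdForm_mul_cutoff` with `0 ≤ c_n ≤ 1` and compact supports
(one exists: `exists_cutoff_tendsto_adelicSiegelFunctional_sdForm`).
[cite: Weil1965, Chap. IV n° 41, (35) p. 59; Chap. I n° 2, Lemmes 3 and 5, pp. 7–10] -/
theorem integral_adelicSiegelMeasure_sdForm_eq (μ : Measure (Fin m → AdeleRing (𝓞 F) F))
    [μ.IsAddHaarMeasure] (hm : 4 < m) {S : Matrix (Fin m) (Fin m) F} (hS : S.IsSymm) (hdet : S.det ≠ 0)
    (hh : Continuous fun x : Fin m → AdeleRing (𝓞 F) F => sdForm F (ratMatrix F S) x)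
    (hB : ∀ Φ ∈ piSchwartzBruhat F (Fin m), Summable fun ξ : F =>
      ‖adelicSiegelCoeff F (Fin m) μ (fun x => sdForm F (ratMatrix F S) x) Φ ξ‖)
    {θ : ℕ → (Fin m → mixedSpace F) → ℝ} (hθs : ∀ n, ContDiff ℝ ∞ (θ n))
    (hθb : ∀ N : ℕ, ∃ C : ℝ, 0 ≤ C ∧ ∀ n, ∀ i ≤ N, ∀ y, ‖iteratedFDeriv ℝ i (θ n) y‖ ≤ C)
    {U : ℕ → Set (Fin m → FiniteAdeleRing (𝓞 F) F)} (hUc : ∀ n, IsCompact (U n)) (hUo : ∀ n, IsOpen (U n))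
    (hUmono : Monotone U) (hUcov : ∀ z, ∃ n, z ∈ U n)
    (c : ℕ → (Fin m → AdeleRing (𝓞 F) F) → ℝ)
    (hc : ∀ n v, c n v = θ n (piArch F (Fin m) v) * (U n).indicator 1 (piFinite F (Fin m) v))
    (hcS : ∀ n, c n ∈ piSchwartzBruhatReal F (Fin m)) (hc01 : ∀ n v, c n v ∈ Icc (0 : ℝ) 1)
    (hcs : ∀ n, HasCompactSupport (c n)) (hct : ∀ v, Tendsto (fun n => c n v) atTop (𝓝 1))
    (Ψ : piSchwartzBruhatReal F (Fin m)) (hΨ : 0 ≤ (Ψ : (Fin m → AdeleRing (𝓞 F) F) → ℝ)) :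
    Integrable (Ψ : (Fin m → AdeleRing (𝓞 F) F) → ℝ)
        (adelicSiegelMeasure F (Fin m) μ (fun x => sdForm F (ratMatrix F S) x) hh hB) ∧
      ∫ x, (Ψ : (Fin m → AdeleRing (𝓞 F) F) → ℝ) x ∂(adelicSiegelMeasure F (Fin m) μ (fun x => sdForm F (ratMatrix F S) x) hh hB) =
        adelicSiegelFunctional F (Fin m) μ (fun x => sdForm F (ratMatrix F S) x) hh hB Ψ := by
  obtain ⟨M, hM, hdom⟩ := exists_summable_forall_norm_adelicSiegelCoeff_mul_cutoff_le F μ hm hS hdet hθs hθb hUc hUo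
    hUmono hUcov c hc Ψ
  exact integral_adelicSiegelMeasure_eq_of_dominated F (Fin m) hh hB Ψ hΨ c hcS hc01 hcs hct hM hdom

/-! ## §3 One cut-off sequence for the Siegel–Weil comparison: the dilation family -/

/-- **ONE CUT-OFF SEQUENCE ALONG WHICH `E_X` IS CONTINUOUS**: for `F` totally real, `S ∈ Sym_m(F)` with `det S ≠ 0` and `4 < m`
there are `c_n ∈ 𝒮_ℝ(𝔸_F^m)` with `0 ≤ c_n ≤ 1`, compact support, `c_n(v) = 1` eventually for every `v` (so `c_n → 1` pointwise) —
the dilation cut-offs `β_n ⊗ 𝟙_{U_n}` of ★ `exists_tensor_cutoff_dilate` — such that `E_X(Ψ c_n) → E_X(Ψ)` for every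
`Ψ ∈ 𝒮_ℝ(𝔸_F^m)` and `∫ Ψ dE_X = E_X(Ψ)` for every `Ψ ≥ 0`: the inputs `c`, `hc`, `hcs`, `h₁` of ★
`linearMap_eq_smul_of_fibreMeasure_eq` on the Eisenstein side (the theta side `h₂` is ★ `tendsto_thetaOrbitFunctionalReal_mul`
along the same sequence, from the exported `hcS`, `hc01`, `hct`).
[cite: Weil1965, Chap. I n° 2, Lemme 5 p. 10 and Prop. 2 p. 8; Chap. IV n° 41, (35) p. 59] -/
theorem exists_cutoff_tendsto_adelicSiegelFunctional_sdForm (μ : Measure (Fin m → AdeleRing (𝓞 F) F))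
    [μ.IsAddHaarMeasure] (hm : 4 < m) {S : Matrix (Fin m) (Fin m) F} (hS : S.IsSymm) (hdet : S.det ≠ 0)
    (hh : Continuous fun x : Fin m → AdeleRing (𝓞 F) F => sdForm F (ratMatrix F S) x)
    (hB : ∀ Φ ∈ piSchwartzBruhat F (Fin m), Summable fun ξ : F =>
      ‖adelicSiegelCoeff F (Fin m) μ (fun x => sdForm F (ratMatrix F S) x) Φ ξ‖) :
    ∃ (c : ℕ → (Fin m → AdeleRing (𝓞 F) F) → ℝ) (hcS : ∀ n, c n ∈ piSchwartzBruhatReal F (Fin m)),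
      (∀ n v, c n v ∈ Icc (0 : ℝ) 1) ∧ (∀ n, HasCompactSupport (c n)) ∧ (∀ v, ∀ᶠ n in atTop, c n v = 1) ∧
      (∀ v, Tendsto (fun n => c n v) atTop (𝓝 1)) ∧
      (∀ Ψ : piSchwartzBruhatReal F (Fin m),
        Tendsto (fun n => adelicSiegelFunctional F (Fin m) μ (fun x => sdForm F (ratMatrix F S) x) hh hB
            ⟨(Ψ : (Fin m → AdeleRing (𝓞 F) F) → ℝ) * c n, mul_mem_piSchwartzBruhatReal Ψ.2 (hcS n)⟩) atTop
          (𝓝 (adelicSiegelFunctional F (Fin m) μ (fun x => sdForm F (ratMatrix F S) x) hh hB Ψ))) ∧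
      ∀ Ψ : piSchwartzBruhatReal F (Fin m), 0 ≤ (Ψ : (Fin m → AdeleRing (𝓞 F) F) → ℝ) →
        Integrable (Ψ : (Fin m → AdeleRing (𝓞 F) F) → ℝ)
            (adelicSiegelMeasure F (Fin m) μ (fun x => sdForm F (ratMatrix F S) x) hh hB) ∧
          ∫ x, (Ψ : (Fin m → AdeleRing (𝓞 F) F) → ℝ) x
              ∂(adelicSiegelMeasure F (Fin m) μ (fun x => sdForm F (ratMatrix F S) x) hh hB) =
            adelicSiegelFunctional F (Fin m) μ (fun x => sdForm F (ratMatrix F S) x) hh hB Ψ := by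
  obtain ⟨U, β, hUc, hUo, hUmono, hUcov, -, hβ, hcS, hc01, hcs, hev⟩ := exists_tensor_cutoff_dilate F (Fin m)
  set c : ℕ → (Fin m → AdeleRing (𝓞 F) F) → ℝ := fun n v => β n (piArch F (Fin m) v) * (U n).indicator 1 (piFinite F (Fin m) v)
    with hc_def
  have hc : ∀ n v, c n v = β n (piArch F (Fin m) v) * (U n).indicator 1 (piFinite F (Fin m) v) := fun n v => rfl
  have hθs : ∀ n, ContDiff ℝ ∞ (β n) := fun n => (β n).contDiff
  have hθb := exists_forall_norm_iteratedFDeriv_bump_dilate_le β hβ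
  have hct : ∀ v, Tendsto (fun n => c n v) atTop (𝓝 1) := fun v =>
    tendsto_const_nhds.congr' ((hev v).mono fun n hn => hn.symm)
  have hc1 : ∀ n v, |c n v| ≤ 1 := fun n v => abs_le.2 ⟨by linarith [(hc01 n v).1], (hc01 n v).2⟩
  exact ⟨c, hcS, hc01, hcs, hev, hct,
    fun Ψ => tendsto_adelicSiegelFunctional_sdForm_mul_cutoff F μ hm hS hdet hh hB hθs hθb hUc hUo hUmono hUcov c hc hcS hc1 hct Ψ,
    fun Ψ hΨ => integral_adelicSiegelMeasure_sdForm_eq F μ hm hS hdet hh hB hθs hθb hUc hUo hUmono hUcov c hc hcS hc01 hcs hct Ψ hΨ⟩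

end Eisenstein

end Literature.NumberTheory.Weil1965

end
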